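import Literature.MathematicalPhysics.QuantumLattice.InterClusterKernelIdentification
import HarnessLib

/-!
# The inter-cluster kernel as a reduced-resolvent matrix element between hop vectors

Topic `MathematicalPhysics/QuantumLattice`; continues `ClusterPairBosonCouplings.lean` (`interClusterKernel`,
`pairResolvent`, `bondHopping`) and `InterClusterKernelIdentification.lean` (`tensorVec`, `kroneckerSum`,
`pairResolvent_eq_dotProduct_reducedResolvent_kroneckerSum`).

In the tensor-coordinate picture of two clusters (vectors on `Finset ι × Finset ι`, local Hamiltonian the
Kronecker sum `H ⊗ 1 + 1 ⊗ H`, NO Jordan–Wigner signs), the inter-cluster hopping `V = −Σ W (c†c' + h.c.)` applied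
to a product state `x ⊗ y` with even factors is — up to the fermionic sign bookkeeping done ONCE in the big Fock
space (`ClusterProductHops`: pair-transfer and out-and-back processes carry opposite relative signs) — the
**hop vector**
`w(x, y) = Σ_{(p,q) ∈ B, σ} (ε₁ · c†_{pσ} x ⊗ c_{qσ} y + ε₂ · c_{pσ} x ⊗ c†_{qσ} y)`, `ε̄₁ε₁ = ε̄₂ε₂ = 1`,
`ε̄₁ε₂ = ε̄₂ε₁ = −1`. This file proves the purely algebraic identity

* `star_hopVec_dotProduct_reducedResolvent_hopVec` — `⟨w(x',y'), S_{H⊗1+1⊗H}(E) w(x,y)⟩ = −Σ_{ij i'j'} W_{ij} W_{i'j'}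
  [K₁ + K₂ − K₃ − K₄]` with the four `pairResolvent`s of `interClusterKernel` at an ARBITRARY energy `E`
  (`W = bondHopping B`), and
* `star_hopVec_dotProduct_reducedResolvent_hopVec_eq_neg_interClusterKernel` — at `E = (E(κ) + E(κ'))/2` and
  cluster states `φ`, this is `−interClusterKernel hH φ (bondHopping B) κ' κ` on the nose;

together with the reindexing `sum_sum_bondHopping_mul` of orbital double sums weighted by `bondHopping B` as sums
over bonds and spins. (Tsai–Kivelson 2006, App. A (A1)–(A3); Kato 1966, I-§5.3 (5.32) for the reduced resolvent.)

References: W.-F. Tsai, S. A. Kivelson, PRB 73 (2006) 214510, App. A [TsaiKivelson2006]; T. Kato,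
*Perturbation Theory for Linear Operators* (1966), I-§5.3 [Kato1966].
-/

noncomputable section

namespace Literature.MathematicalPhysics.QuantumLattice

open Matrix Finset TwoCluster

section Reindex

variable {Λ : Type*} [LinearOrder Λ] [Fintype Λ]

/-- A double sum of an indicator of a finite set of pairs. [folklore] -/
theorem sum_sum_ite_mem_eq_sum {α β γ : Type*} [Fintype α] [Fintype β] [DecidableEq α] [DecidableEq β]
    [AddCommMonoid γ] (S : Finset (α × β)) (g : α → β → γ) :
    ∑ a, ∑ b, (if (a, b) ∈ S then g a b else 0) = ∑ q ∈ S, g q.1 q.2 := by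
  rw [← Finset.sum_product' (s := Finset.univ) (t := Finset.univ) (f := fun a b => if (a, b) ∈ S then g a b else 0),
    Finset.univ_product_univ, ← Finset.sum_filter]
  congr 1
  ext q
  simp

/-- **Orbital double sums weighted by `bondHopping B` are sums over bonds and spins**:
`Σ_{i,j} W_{ij} F(i,j) = Σ_{(p,q) ∈ B} Σ_σ F((p,σ),(q,σ))` for `W = bondHopping B` (spin-diagonal unit hopping on
the site pairs of `B`). [folklore] -/
theorem sum_sum_bondHopping_mul (B : Finset (Λ × Λ)) (F : Orb Λ → Orb Λ → ℂ) :
    ∑ i, ∑ j, ((bondHopping B i j : ℝ) : ℂ) * F i j = ∑ q ∈ B, ∑ σ : Fin 2, F (orb q.1 σ) (orb q.2 σ) := by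
  classical
  have horb : ∀ G : Orb Λ → ℂ, ∑ i, G i = ∑ x : Λ, ∑ σ : Fin 2, G (orb x σ) := fun G => by
    rw [← Fintype.sum_prod_type', ← (toLex : Λ × Fin 2 ≃ Orb Λ).sum_comp]
  have hW : ∀ (x y : Λ) (σ τ : Fin 2), ((bondHopping B (orb x σ) (orb y τ) : ℝ) : ℂ) =
      if σ = τ ∧ (x, y) ∈ B then 1 else 0 := by
    intro x y σ τ
    change (((if σ = τ ∧ (x, y) ∈ B then 1 else 0 : ℝ)) : ℂ) = _
    split_ifs <;> simp
  simp only [horb, hW, ite_mul, one_mul, zero_mul, ite_and, Finset.sum_ite_eq, Finset.mem_univ, if_true]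
  -- `Σ_x Σ_σ Σ_y [(x,y) ∈ B] F = Σ_x Σ_y [(x,y) ∈ B] Σ_σ F`
  refine (Finset.sum_congr rfl fun x _ => Finset.sum_comm).trans ?_
  refine (Finset.sum_congr rfl fun x _ => Finset.sum_congr rfl fun y _ =>
    show (∑ σ : Fin 2, if (x, y) ∈ B then F (orb x σ) (orb y σ) else 0) =
      if (x, y) ∈ B then ∑ σ : Fin 2, F (orb x σ) (orb y σ) else 0 by split_ifs <;> simp).trans ?_
  exact sum_sum_ite_mem_eq_sum B fun a b => ∑ σ : Fin 2, F (orb a σ) (orb b σ)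

/-- The quadruple version: `Σ_{ij i'j'} W_{ij} W_{i'j'} G = Σ_{(q,σ)} Σ_{(q',σ')} G` over bonds and spins.
[folklore] -/
theorem sum_bondHopping_mul_bondHopping_mul (B : Finset (Λ × Λ)) (G : Orb Λ → Orb Λ → Orb Λ → Orb Λ → ℂ) :
    ∑ i, ∑ j, ∑ i', ∑ j', ((bondHopping B i j * bondHopping B i' j' : ℝ) : ℂ) * G i j i' j' =
      ∑ q ∈ B, ∑ σ : Fin 2, ∑ q' ∈ B, ∑ σ' : Fin 2, G (orb q.1 σ) (orb q.2 σ) (orb q'.1 σ') (orb q'.2 σ') := by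
  have h : ∀ i j, ∑ i', ∑ j', ((bondHopping B i j * bondHopping B i' j' : ℝ) : ℂ) * G i j i' j' =
      ((bondHopping B i j : ℝ) : ℂ) * ∑ i', ∑ j', ((bondHopping B i' j' : ℝ) : ℂ) * G i j i' j' := by
    intro i j
    rw [Finset.mul_sum]
    refine Finset.sum_congr rfl fun i' _ => ?_
    rw [Finset.mul_sum]
    refine Finset.sum_congr rfl fun j' _ => ?_
    push_cast
    ring
  refine (Finset.sum_congr rfl fun i _ => Finset.sum_congr rfl fun j _ => h i j).trans ?_
  rw [sum_sum_bondHopping_mul B (fun i j => ∑ i', ∑ j', ((bondHopping B i' j' : ℝ) : ℂ) * G i j i' j')]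
  exact Finset.sum_congr rfl fun q _ => Finset.sum_congr rfl fun σ _ => sum_sum_bondHopping_mul B _

end Reindex

section HopVectors

variable {Λ : Type*} [LinearOrder Λ] [Fintype Λ] {H : Matrix (Finset (Orb Λ)) (Finset (Orb Λ)) ℂ}

omit [LinearOrder Λ] [Fintype Λ] in
/-- The one-term sesquilinear identity behind the hop-vector matrix element: with `ε̄₁ε₁ = ε̄₂ε₂ = 1` and
`ε̄₁ε₂ = ε̄₂ε₁ = −1`, `⟨ε₁t₁' + ε₂t₂', S(ε₁t₁ + ε₂t₂)⟩ = −(⟨t₁',St₂⟩ + ⟨t₂',St₁⟩ − ⟨t₂',St₂⟩ − ⟨t₁',St₁⟩)`.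
[folklore] -/
theorem star_smul_add_smul_dotProduct_mulVec_smul_add_smul {N : Type*} [Fintype N] (S : Matrix N N ℂ)
    {ε₁ ε₂ : ℂ} (h₁₁ : star ε₁ * ε₁ = 1) (h₂₂ : star ε₂ * ε₂ = 1) (h₁₂ : star ε₁ * ε₂ = -1)
    (h₂₁ : star ε₂ * ε₁ = -1) (t₁' t₂' t₁ t₂ : N → ℂ) :
    star (ε₁ • t₁' + ε₂ • t₂') ⬝ᵥ (S *ᵥ (ε₁ • t₁ + ε₂ • t₂)) =
      -(star t₁' ⬝ᵥ (S *ᵥ t₂) + star t₂' ⬝ᵥ (S *ᵥ t₁) - star t₂' ⬝ᵥ (S *ᵥ t₂) - star t₁' ⬝ᵥ (S *ᵥ t₁)) := by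
  simp only [star_add, star_smul, add_dotProduct, smul_dotProduct, mulVec_add, mulVec_smul, dotProduct_add,
    dotProduct_smul, smul_eq_mul]
  linear_combination (star t₁' ⬝ᵥ (S *ᵥ t₁)) * h₁₁ + (star t₁' ⬝ᵥ (S *ᵥ t₂)) * h₁₂ +
    (star t₂' ⬝ᵥ (S *ᵥ t₁)) * h₂₁ + (star t₂' ⬝ᵥ (S *ᵥ t₂)) * h₂₂

/-- **Hop-vector matrix elements of the two-cluster reduced resolvent, at any energy.** For a Hermitian cluster
Hamiltonian `H`, boundary bonds `B` (`W = bondHopping B`), signs with `ε̄₁ε₁ = ε̄₂ε₂ = 1`, `ε̄₁ε₂ = ε̄₂ε₁ = −1`,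
and the hop vectors `w(x,y) = Σ_{(p,q) ∈ B, σ} (ε₁ c†_{pσ}x ⊗ c_{qσ}y + ε₂ c_{pσ}x ⊗ c†_{qσ}y)`:
`⟨w(x',y'), S_{H⊗1+1⊗H}(E) w(x,y)⟩ = −Σ_{i j i' j'} W_{ij} W_{i'j'} [K(c†_{i'}x', c_i x; c_{j'}y', c†_j y)
 + K(c_{i'}x', c†_i x; c†_{j'}y', c_j y) − K(c_{i'}x', c_i x; c†_{j'}y', c†_j y) − K(c†_{i'}x', c†_i x; c_{j'}y', c_j y)]`,
`K = pairResolvent hH E` — the bracket of `interClusterKernel` with the energy left free.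
[cite: TsaiKivelson2006, App. A (A1)] -/
theorem star_hopVec_dotProduct_reducedResolvent_hopVec (hH : H.IsHermitian) (B : Finset (Λ × Λ)) (E : ℝ)
    {ε₁ ε₂ : ℂ} (h₁₁ : star ε₁ * ε₁ = 1) (h₂₂ : star ε₂ * ε₂ = 1) (h₁₂ : star ε₁ * ε₂ = -1)
    (h₂₁ : star ε₂ * ε₁ = -1) (x' y' x y : Fock (Orb Λ)) :
    star (∑ q ∈ B, ∑ σ : Fin 2,
        (ε₁ • tensorVec (creation (orb q.1 σ) *ᵥ x') (annihilation (orb q.2 σ) *ᵥ y') +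
          ε₂ • tensorVec (annihilation (orb q.1 σ) *ᵥ x') (creation (orb q.2 σ) *ᵥ y'))) ⬝ᵥ
      (reducedResolvent (kroneckerSum H H) E *ᵥ
        ∑ q ∈ B, ∑ σ : Fin 2,
          (ε₁ • tensorVec (creation (orb q.1 σ) *ᵥ x) (annihilation (orb q.2 σ) *ᵥ y) +
            ε₂ • tensorVec (annihilation (orb q.1 σ) *ᵥ x) (creation (orb q.2 σ) *ᵥ y))) =
      -∑ i, ∑ j, ∑ i', ∑ j', ((bondHopping B i j * bondHopping B i' j' : ℝ) : ℂ) *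
        (pairResolvent hH E (creation i' *ᵥ x') (annihilation i *ᵥ x) (annihilation j' *ᵥ y') (creation j *ᵥ y) +
          pairResolvent hH E (annihilation i' *ᵥ x') (creation i *ᵥ x) (creation j' *ᵥ y') (annihilation j *ᵥ y) -
          pairResolvent hH E (annihilation i' *ᵥ x') (annihilation i *ᵥ x) (creation j' *ᵥ y') (creation j *ᵥ y) -
          pairResolvent hH E (creation i' *ᵥ x') (creation i *ᵥ x) (annihilation j' *ᵥ y') (annihilation j *ᵥ y)) := by
  simp only [pairResolvent_eq_dotProduct_reducedResolvent_kroneckerSum]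
  set S := reducedResolvent (kroneckerSum H H) E
  rw [sum_bondHopping_mul_bondHopping_mul, ← Finset.sum_neg_distrib, mulVec_sum, dotProduct_sum]
  refine Finset.sum_congr rfl fun q _ => ?_
  rw [← Finset.sum_neg_distrib, mulVec_sum, dotProduct_sum]
  refine Finset.sum_congr rfl fun σ _ => ?_
  rw [← Finset.sum_neg_distrib, star_sum, sum_dotProduct]
  refine Finset.sum_congr rfl fun q' _ => ?_
  rw [← Finset.sum_neg_distrib, star_sum, sum_dotProduct]
  refine Finset.sum_congr rfl fun σ' _ => ?_
  exact star_smul_add_smul_dotProduct_mulVec_smul_add_smul S h₁₁ h₂₂ h₁₂ h₂₁ _ _ _ _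

/-- **The inter-cluster kernel is minus the hop-vector matrix element at the mean energy**: for cluster states
`φ` and `E = (E(κ) + E(κ'))/2`,
`⟨w(φ_{κ'.1}, φ_{κ'.2}), S_{H⊗1+1⊗H}(E) w(φ_{κ.1}, φ_{κ.2})⟩ = −interClusterKernel hH φ (bondHopping B) κ' κ` — the
tensor-coordinate form of `interClusterKernel_eq` (there on `Fock (ι ⊕ₗ ι)` with the fermionic signs produced by the
Jordan–Wigner strings; here the signs `ε₁, ε₂` are data of the hop vectors). [cite: TsaiKivelson2006, App. A (A1)] -/
theorem star_hopVec_dotProduct_reducedResolvent_hopVec_eq_neg_interClusterKernel (hH : H.IsHermitian)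
    (B : Finset (Λ × Λ)) {ε₁ ε₂ : ℂ} (h₁₁ : star ε₁ * ε₁ = 1) (h₂₂ : star ε₂ * ε₂ = 1)
    (h₁₂ : star ε₁ * ε₂ = -1) (h₂₁ : star ε₂ * ε₁ = -1) {K : Type*} (φ : K → Fock (Orb Λ)) (κ' κ : K × K) :
    star (∑ q ∈ B, ∑ σ : Fin 2,
        (ε₁ • tensorVec (creation (orb q.1 σ) *ᵥ φ κ'.1) (annihilation (orb q.2 σ) *ᵥ φ κ'.2) +
          ε₂ • tensorVec (annihilation (orb q.1 σ) *ᵥ φ κ'.1) (creation (orb q.2 σ) *ᵥ φ κ'.2))) ⬝ᵥ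
      (reducedResolvent (kroneckerSum H H) ((pairEnergy H φ κ + pairEnergy H φ κ') / 2) *ᵥ
        ∑ q ∈ B, ∑ σ : Fin 2,
          (ε₁ • tensorVec (creation (orb q.1 σ) *ᵥ φ κ.1) (annihilation (orb q.2 σ) *ᵥ φ κ.2) +
            ε₂ • tensorVec (annihilation (orb q.1 σ) *ᵥ φ κ.1) (creation (orb q.2 σ) *ᵥ φ κ.2))) =
      -interClusterKernel hH φ (bondHopping B) κ' κ := by
  rw [star_hopVec_dotProduct_reducedResolvent_hopVec hH B _ h₁₁ h₂₂ h₁₂ h₂₁]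
  rfl

end HopVectors

end Literature.MathematicalPhysics.QuantumLattice

end
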